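import Summits.QuantumFields.QCD.Theses.NestedDissectionSea

/-!
# `CoerciveOfDilute` (crux stmt-QuantumFields-14759), line `Sketch` (cards `sea-pays-its-own-poles` +
# `two-regime-splice`): shared vocabulary of the registered stubs

The DEFINITIONS over which the registered stubs of the line `Sketch` of the crux
`Summit.QuantumFields.QCD.Theses.NestedDissectionSea.CoerciveOfDilute` (route `NestedDissectionSea`, sub-problem
`QCD`) are typed — moved into a module so that the skeleton `Cruxes/CoerciveOfDilute/Lines/Sketch.lean`, the
landed stub files and the kernel-checked composition share ONE copy, and a planner promoting a stub to an item can
import the exact vocabulary (precedent: `NestedDissectionSeaSeaFactorisationBridgeLineDefs.lean`). Nothing is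
asserted: every declaration is a `def` (two objects and `Prop`-valued statements the LINE posits — not published
facts, hence NO provenance tags — a tagged `def : Prop` here would be relocated to Literature as a named fact, which these conjectural line statements are not) plus one definitional lemma (`sheet_iff`).

Contents. §0 the two objects: `sheet s` (the internal separator `Σ` of the corner-`0` box of sides `s`, read on the
ambient Wilson index set of the torus) and `torusSheetGreen U μ s = (D_T(U, μ)⁻¹)_ΣΣ` (the TORUS quark propagator
compressed to `Σ`; its inverse is the Schur complement of the torus Wilson–Dirac matrix onto `Σ`, whose smallest
singular value is an exact factor of the phase-quenched weight `|det D_T(μ)|`). §1 the research statements of the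
line: `TorusSheetMoment` (M_Σ), `WallTransfer` (T), `FineRegimeLaw` (F); the intermediate `CoarseLaw`; the target
`SeparatorLawOnBranch`; the bookkeeping statement `SheetGreenIntegrable`. §2 the two statements of crux 13901's
built line through which this line reaches the crux: `PinnedDilutionOnPhysicalBranch` (= the registered external stub
`stub_pinnedDilutionOnPhysicalBranch` of `Cruxes/CoerciveSea/Lines/chirality_collapses_pseudospectrum.lean`, i.e.
item 13900 + the physical-branch clause) and `SeparatorLawLarge` (= the registered `stub_separatorLawLarge` there,
verbatim), so that the landed composition `coerciveSea_of_pinnedDilutionOnBranch_of_separatorLawLarge` (p108820)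
applies by definitional unfolding.

All quantifier shells are VERBATIM those of the route items (`let N / mq / wt / P` as in `CoerciveSea`); the matrix
norm is Mathlib's `ℓ²` operator norm (`open scoped Matrix.Norms.L2Operator`). The skeleton's docstrings carry the
mechanism and the reshape history; here only what a reader of a stub signature needs.
-/

noncomputable section

open scoped BigOperators Classical Matrix.Norms.L2Operator
open MeasureTheory Filter Matrix
open Literature.MathematicalPhysics.QuantumLattice Literature.MathematicalPhysics.QuantumFieldTheory
  Literature.Probability.LatticeModels

namespace Summit.QuantumFields.QCD.Cruxes.CoerciveOfDilute.SeaPaysPoles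

/-! ## §0 The two objects: the internal separator as a torus predicate; the compressed torus propagator -/

section Vocabulary

variable {N : ℕ} [NeZero N]

/-- The internal separator `Σ` of the corner-`0` open box of sides `s` (the box minus its sixteen children
interiors), as a predicate on the FULL Wilson index set of the torus (site, colour, spin). -/
def sheet (s : Fin 4 → ℕ) (p : TorusSite 4 N × Fin 3 × Fin 4) : Prop :=
  wilsonBox (0 : TorusSite 4 N) s p ∧ ∀ ε : Fin 4 → Bool, ¬ wilsonBox (halfCorner s ε) (halfSides s ε) p

/-- The TORUS quark propagator `D_T(μ)⁻¹` (full periodic `r = 1` Wilson–Dirac matrix of the torus, fundamental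
`SU(3)`, Mathlib's nonsingular inverse — junk `0` when `det D_T(μ) = 0`) compressed to the internal separator of
the corner-`0` box of sides `s`: `(D_T(μ)⁻¹)_ΣΣ`. When `D_T(μ)` is invertible its inverse is the Schur complement
of the torus matrix onto `Σ`. -/
def torusSheetGreen (U : GaugeConfig 4 N (Matrix.specialUnitaryGroup (Fin 3) ℂ)) (μ : ℝ) (s : Fin 4 → ℕ) :
    Matrix {p // sheet (N := N) s p} {p // sheet (N := N) s p} ℂ :=
  (wilsonDirac (fundamentalRep (Fin 3)) U μ 1)⁻¹.toBlock (sheet s) (sheet s)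

omit [NeZero N] in
/-- `sheet s` is exactly the crux's internal separator `{p ∈ box | ¬ childrenInterior s p}` read on the ambient
index set. -/
theorem sheet_iff (s : Fin 4 → ℕ) (p : TorusSite 4 N × Fin 3 × Fin 4) :
    sheet (N := N) s p ↔ ∃ h : wilsonBox (0 : TorusSite 4 N) s p, ¬ childrenInterior s ⟨p, h⟩ := by
  simp only [sheet, childrenInterior, not_exists]
  constructor
  · rintro ⟨h, h'⟩; exact ⟨h, h'⟩
  · rintro ⟨h, h'⟩; exact ⟨h, h'⟩

end Vocabulary

/-- Local notation: the colour group `SU(3)`. -/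
local notation "𝔾" => Matrix.specialUnitaryGroup (Fin 3) ℂ

/-! ## §1 The statements of the line -/

/-- **(M_Σ) `TorusSheetMoment`** — the heart of card `sea-pays-its-own-poles`. Along every admissible
regularisation on the physical branch (`HasMassScaling`, `HasAsymptoticScaling`, `mcrit k → 0`), for every
physical window `ℓ > 0` and positive mass tuple there are `R > 0`, a minimal side `S₀` and `C > 0` such that,
eventually in `k`, on every odd torus of physical side `≥ R`, for every roughly cubic corner-`0` window box with
all sides `≥ S₀` and every flavour `f`, the PHASE-QUENCHED MEAN of the operator norm of the torus quark
propagator AT THE SEA MASS `m_f(k)` compressed to the cell's internal separator is at most `C s₀`: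
`E_pq ‖(D_T(m_f(k))⁻¹)_ΣΣ‖ ≤ C · s 0`. The integrand `‖(D_T⁻¹)_ΣΣ‖ · ∏_f |det D_T(m_f)|` is bounded and
measurable (`SheetGreenIntegrable`), so the mean is an honest Bochner ratio; the content is the `k`-UNIFORM size
(bulk `O(log s₀)` by a deterministic high-mode cut, physical modes `O(Z_m)`, each artefact carrier `O(ρ_*)`,
`ρ_* ∝ a_k^{-1/2} ≪ s₀ ∝ a_k^{-1}`). -/
def TorusSheetMoment : Prop :=
  ∀ (Nf : ℕ) (reg : QCDRegularisation Nf), (Nf = 2 ∨ Nf = 3) → reg.HasMassScaling →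
    (reg.scheme 0 0 0).HasAsymptoticScaling → Tendsto reg.mcrit atTop (nhds 0) →
    ∀ ℓ : ℝ, 0 < ℓ → ∀ m : Fin Nf → ℝ, (∀ f, 0 < m f) →
    ∃ R : ℝ, 0 < R ∧ ∃ S₀ : ℕ, ∃ C : ℝ, 0 < C ∧ ∀ᶠ k : ℕ in atTop, ∀ S : ℕ, R ≤ reg.a k * (2 * S + 1) →
      let N : ℕ := 2 * S + 1
      let mq : Fin Nf → ℝ := fun f => reg.mcrit k + reg.a k * m f / reg.Zm k
      let wt : GaugeConfig 4 N 𝔾 → ℝ := fun U => ∏ f, ‖fermionDet (wilsonDirac (fundamentalRep (Fin 3)) U (mq f) 1)‖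
      let E : (GaugeConfig 4 N 𝔾 → ℝ) → ℝ := fun F =>
        (∫ U, F U * wt U ∂(wilsonMeasure (d := 4) (L := N) (fundamentalRep (Fin 3)) (reg.β k))) /
          (∫ U, wt U ∂(wilsonMeasure (d := 4) (L := N) (fundamentalRep (Fin 3)) (reg.β k)))
      ∀ s : Fin 4 → ℕ, (∀ i, 2 ≤ s i ∧ s i ≤ N ∧ (s i : ℝ) * reg.a k ≤ ℓ) → (∀ i, S₀ ≤ s i) →
        (∀ i j, s i ≤ 2 * s j) → ∀ f : Fin Nf,
        E (fun U => ‖torusSheetGreen U (mq f) s‖) ≤ C * s 0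

/-- **(T) `WallTransfer`** — Dirichlet separator singular ⇒ torus sheet propagator large, off an exceptional
event of power-law small probability, on the COARSE levels only (reshaped by the lead from the card's
`B a_k^γ t^{-γ'}` to the weaker `B t^{α_w}` on `t ∈ [a_k^γ, 1]`, which is all the composition consumes). Along
every physical-branch admissible regularisation, positive tuple and window there are `R > 0`, `S₀`, `C_w ≥ 1`,
`γ > 0`, `α_w > 0`, `B ≥ 0` such that eventually in `k`, on large tori, for large roughly cubic window boxes,
every flavour and every coarse level `t ∈ [a_k^γ, 1]`: the phase-quenched probability that the separator is
`(t/s₀)`-singular (the crux's event) WHILE the torus propagator compressed to the same separator stays below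
`s₀/(C_w t)` is `≤ B t^{α_w}`. Mechanism (card): a sub-gap Dirichlet direction is torus-visible up to the
second-order wall shift `≍ ‖K‖²θ`, `θ` its mass on the outer wall layer; the exceptional set is "a carrier within
`ρ_*(C s₀/t)^{1/3}` of the outer wall", a fraction `≍ a_k^{1/6} t^{-1/3} ≤ t^{1/(6γ) - 1/3}` of positions. -/
def WallTransfer : Prop :=
  ∀ (Nf : ℕ) (reg : QCDRegularisation Nf), (Nf = 2 ∨ Nf = 3) → reg.HasMassScaling →
    (reg.scheme 0 0 0).HasAsymptoticScaling → Tendsto reg.mcrit atTop (nhds 0) →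
    ∀ ℓ : ℝ, 0 < ℓ → ∀ m : Fin Nf → ℝ, (∀ f, 0 < m f) →
    ∃ R : ℝ, 0 < R ∧ ∃ S₀ : ℕ, ∃ Cw : ℝ, 1 ≤ Cw ∧ ∃ γ : ℝ, 0 < γ ∧ ∃ αw : ℝ, 0 < αw ∧ ∃ B : ℝ, 0 ≤ B ∧
      ∀ᶠ k : ℕ in atTop, ∀ S : ℕ, R ≤ reg.a k * (2 * S + 1) →
      let N : ℕ := 2 * S + 1
      let mq : Fin Nf → ℝ := fun f => reg.mcrit k + reg.a k * m f / reg.Zm k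
      let wt : GaugeConfig 4 N 𝔾 → ℝ := fun U => ∏ f, ‖fermionDet (wilsonDirac (fundamentalRep (Fin 3)) U (mq f) 1)‖
      let P : (GaugeConfig 4 N 𝔾 → Prop) → ℝ := fun Ev =>
        (∫ U, (if Ev U then (1 : ℝ) else 0) * wt U ∂(wilsonMeasure (d := 4) (L := N) (fundamentalRep (Fin 3)) (reg.β k))) /
          (∫ U, wt U ∂(wilsonMeasure (d := 4) (L := N) (fundamentalRep (Fin 3)) (reg.β k)))
      ∀ s : Fin 4 → ℕ, (∀ i, 2 ≤ s i ∧ s i ≤ N ∧ (s i : ℝ) * reg.a k ≤ ℓ) → (∀ i, S₀ ≤ s i) →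
        (∀ i j, s i ≤ 2 * s j) → ∀ f : Fin Nf, ∀ t : ℝ, reg.a k ^ γ ≤ t → t ≤ 1 →
        P (fun U => HasSingularSeparator U (mq f) s (t / s 0) ∧
            ‖torusSheetGreen U (mq f) s‖ ≤ (s 0 : ℝ) / (Cw * t)) ≤ B * t ^ αw

/-- **`CoarseLaw`** — clause (i) on the COARSE levels only: `P_pq(HasSingularSeparator U m_f(k) s (t/s₀)) ≤
A t^α` for `t ∈ [a_k^γ, 1]`, on large roughly cubic window boxes, along every physical-branch admissible
regularisation and positive tuple. (M_Σ) ∧ (T) give it by Markov and a union bound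
(`stub_coarseOfMomentAndTransfer`). -/
def CoarseLaw : Prop :=
  ∀ (Nf : ℕ) (reg : QCDRegularisation Nf), (Nf = 2 ∨ Nf = 3) → reg.HasMassScaling →
    (reg.scheme 0 0 0).HasAsymptoticScaling → Tendsto reg.mcrit atTop (nhds 0) →
    ∀ ℓ : ℝ, 0 < ℓ → ∀ m : Fin Nf → ℝ, (∀ f, 0 < m f) →
    ∃ R : ℝ, 0 < R ∧ ∃ S₀ : ℕ, ∃ γ : ℝ, 0 < γ ∧ ∃ A : ℝ, 0 < A ∧ ∃ α : ℝ, 0 < α ∧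
      ∀ᶠ k : ℕ in atTop, ∀ S : ℕ, R ≤ reg.a k * (2 * S + 1) →
      let N : ℕ := 2 * S + 1
      let mq : Fin Nf → ℝ := fun f => reg.mcrit k + reg.a k * m f / reg.Zm k
      let wt : GaugeConfig 4 N 𝔾 → ℝ := fun U => ∏ f, ‖fermionDet (wilsonDirac (fundamentalRep (Fin 3)) U (mq f) 1)‖
      let P : (GaugeConfig 4 N 𝔾 → Prop) → ℝ := fun Ev =>
        (∫ U, (if Ev U then (1 : ℝ) else 0) * wt U ∂(wilsonMeasure (d := 4) (L := N) (fundamentalRep (Fin 3)) (reg.β k))) /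
          (∫ U, wt U ∂(wilsonMeasure (d := 4) (L := N) (fundamentalRep (Fin 3)) (reg.β k)))
      ∀ s : Fin 4 → ℕ, (∀ i, 2 ≤ s i ∧ s i ≤ N ∧ (s i : ℝ) * reg.a k ≤ ℓ) → (∀ i, S₀ ≤ s i) →
        (∀ i j, s i ≤ 2 * s j) → ∀ f : Fin Nf, ∀ t : ℝ, reg.a k ^ γ ≤ t → t ≤ 1 →
        P (fun U => HasSingularSeparator U (mq f) s (t / s 0)) ≤ A * t ^ α

/-- **(F) `FineRegimeLaw`** — the FIXED-CUTOFF Wegner bound with polynomially lossy constants: the crux's event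
obeys `P_pq ≤ B a_k^{-p} t^{α₀}` for ALL `t ∈ (0,1]`, with `B, p, α₀` independent of `k`, volume and box (the
constant may blow up like a power of `1/a_k`, the exponent may not degrade). Intended engine (card
`two-regime-splice`): single-link Haar / Erdős–Hasler smearing at fixed `β_k`, conditional one-link density
`≤ e^{12β_k}(2·48+1)^{N_f} ×` Haar by Nikolskii with `e^{12β_k}` polynomial in `1/a_k` by asymptotic scaling, and a
squared-gradient floor `≥ 1/poly(s)`. -/
def FineRegimeLaw : Prop :=
  ∀ (Nf : ℕ) (reg : QCDRegularisation Nf), (Nf = 2 ∨ Nf = 3) → reg.HasMassScaling →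
    (reg.scheme 0 0 0).HasAsymptoticScaling → Tendsto reg.mcrit atTop (nhds 0) →
    ∀ ℓ : ℝ, 0 < ℓ → ∀ m : Fin Nf → ℝ, (∀ f, 0 < m f) →
    ∃ R : ℝ, 0 < R ∧ ∃ S₀ : ℕ, ∃ p : ℝ, 0 ≤ p ∧ ∃ B : ℝ, 0 < B ∧ ∃ α₀ : ℝ, 0 < α₀ ∧
      ∀ᶠ k : ℕ in atTop, ∀ S : ℕ, R ≤ reg.a k * (2 * S + 1) →
      let N : ℕ := 2 * S + 1
      let mq : Fin Nf → ℝ := fun f => reg.mcrit k + reg.a k * m f / reg.Zm k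
      let wt : GaugeConfig 4 N 𝔾 → ℝ := fun U => ∏ f, ‖fermionDet (wilsonDirac (fundamentalRep (Fin 3)) U (mq f) 1)‖
      let P : (GaugeConfig 4 N 𝔾 → Prop) → ℝ := fun Ev =>
        (∫ U, (if Ev U then (1 : ℝ) else 0) * wt U ∂(wilsonMeasure (d := 4) (L := N) (fundamentalRep (Fin 3)) (reg.β k))) /
          (∫ U, wt U ∂(wilsonMeasure (d := 4) (L := N) (fundamentalRep (Fin 3)) (reg.β k)))
      ∀ s : Fin 4 → ℕ, (∀ i, 2 ≤ s i ∧ s i ≤ N ∧ (s i : ℝ) * reg.a k ≤ ℓ) → (∀ i, S₀ ≤ s i) →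
        (∀ i j, s i ≤ 2 * s j) → ∀ f : Fin Nf, ∀ t : ℝ, 0 < t → t ≤ 1 →
        P (fun U => HasSingularSeparator U (mq f) s (t / s 0)) ≤ B * (reg.a k) ^ (-p) * t ^ α₀

/-- **`SeparatorLawOnBranch`** — the line's target: clause (i) of `CoerciveSea` on large roughly cubic window
boxes, for ALL `t ∈ (0,1]`, along every physical-branch admissible regularisation and every positive tuple
(the conclusion of 13901's registered `stub_separatorLawLarge` freed of its pinned-dilute hypothesis and read at
zero threshold). `CoarseLaw ∧ FineRegimeLaw` give it by the splice (`stub_lawOfCoarseAndFine`); it implies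
`SeparatorLawLarge` by weakening. -/
def SeparatorLawOnBranch : Prop :=
  ∀ (Nf : ℕ) (reg : QCDRegularisation Nf), (Nf = 2 ∨ Nf = 3) → reg.HasMassScaling →
    (reg.scheme 0 0 0).HasAsymptoticScaling → Tendsto reg.mcrit atTop (nhds 0) →
    ∀ ℓ : ℝ, 0 < ℓ → ∀ m : Fin Nf → ℝ, (∀ f, 0 < m f) →
    ∃ R : ℝ, 0 < R ∧ ∃ S₀ : ℕ, ∃ C : ℝ, 0 < C ∧ ∃ α : ℝ, 0 < α ∧
      ∀ᶠ k : ℕ in atTop, ∀ S : ℕ, R ≤ reg.a k * (2 * S + 1) →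
      let N : ℕ := 2 * S + 1
      let mq : Fin Nf → ℝ := fun f => reg.mcrit k + reg.a k * m f / reg.Zm k
      let wt : GaugeConfig 4 N 𝔾 → ℝ := fun U => ∏ f, ‖fermionDet (wilsonDirac (fundamentalRep (Fin 3)) U (mq f) 1)‖
      let P : (GaugeConfig 4 N 𝔾 → Prop) → ℝ := fun Ev =>
        (∫ U, (if Ev U then (1 : ℝ) else 0) * wt U ∂(wilsonMeasure (d := 4) (L := N) (fundamentalRep (Fin 3)) (reg.β k))) /
          (∫ U, wt U ∂(wilsonMeasure (d := 4) (L := N) (fundamentalRep (Fin 3)) (reg.β k)))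
      ∀ s : Fin 4 → ℕ, (∀ i, 2 ≤ s i ∧ s i ≤ N ∧ (s i : ℝ) * reg.a k ≤ ℓ) → (∀ i, S₀ ≤ s i) →
        (∀ i j, s i ≤ 2 * s j) → ∀ f : Fin Nf, ∀ t : ℝ, 0 < t → t ≤ 1 →
        P (fun U => HasSingularSeparator U (mq f) s (t / s 0)) ≤ C * t ^ α

/-- **`SheetGreenIntegrable`** — the bookkeeping behind Markov on (M_Σ): (a) the operator norm of the compressed
torus propagator is a measurable function of the gauge field; (b) AT A SEA MASS `μ = m_f` the integrand
`‖(D_T(m_f)⁻¹)_ΣΣ‖ · ∏_{f'} |det D_T(m_{f'})|` is integrable against the Wilson measure — indeed bounded: for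
`det D_T(m_f) ≠ 0`, `|det D_T(m_f)| · (D_T(m_f)⁻¹)_ΣΣ = (adj D_T(m_f))_ΣΣ` is polynomial in the (bounded) link
entries, and Mathlib's inverse is `0` on `{det = 0}`. (The pole is NOT cancelled at a valence mass `μ ∉ {m_f}`,
where `1/|det D_T(μ)|` is not locally integrable across the real hypersurface `{det = 0}`; hence the restriction.)
Provable now. -/
def SheetGreenIntegrable : Prop :=
  (∀ (N : ℕ) [NeZero N] (μ : ℝ) (s : Fin 4 → ℕ),
      Measurable fun U : GaugeConfig 4 N 𝔾 => ‖torusSheetGreen U μ s‖) ∧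
  ∀ (N : ℕ) [NeZero N] (β : ℝ) (Nf : ℕ) (mq : Fin Nf → ℝ) (s : Fin 4 → ℕ) (f : Fin Nf),
      Integrable (fun U : GaugeConfig 4 N 𝔾 =>
          ‖torusSheetGreen U (mq f) s‖ * ∏ f', ‖fermionDet (wilsonDirac (fundamentalRep (Fin 3)) U (mq f') 1)‖)
        (wilsonMeasure (d := 4) (L := N) (fundamentalRep (Fin 3)) β)

/-! ## §2 The two statements of crux 13901's built line through which this line reaches the crux -/

/-- **`PinnedDilutionOnPhysicalBranch`** — VERBATIM the type of the registered external stub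
`stub_pinnedDilutionOnPhysicalBranch` of `Cruxes/CoerciveSea/Lines/chirality_collapses_pseudospectrum.lean`
(= item `NegativeCellsDilute` stmt-13900 WITH the physical-branch clause `mcrit k → 0` for the same witness;
open, external to this line — never briefed). For `N_f ∈ {2,3}` there is ONE admissible regularisation on the
physical branch with `M₀ ≥ 0`, `b₀ ≥ 2`, `ℓ > 0` such that every tuple `m > M₀` has a size `R > 0` with
(ii) windowed local dilution and (iii) the parity pin, both verbatim the clauses of `NegativeCellsDilute`. -/
def PinnedDilutionOnPhysicalBranch : Prop :=
  ∀ Nf : ℕ, (Nf = 2 ∨ Nf = 3) → ∃ reg : QCDRegularisation Nf, reg.HasMassScaling ∧ (reg.scheme 0 0 0).HasAsymptoticScaling ∧ Filter.Tendsto reg.mcrit Filter.atTop (nhds 0) ∧ ∃ M₀ : ℝ, 0 ≤ M₀ ∧ ∃ b₀ : ℕ, 2 ≤ b₀ ∧ ∃ ℓ : ℝ, 0 < ℓ ∧ ∀ m : Fin Nf → ℝ, (∀ f, M₀ < m f) → ∃ R : ℝ, 0 < R ∧ (∀ ε : ℝ, 0 < ε → ∀ᶠ k : ℕ in Filter.atTop,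 ∀ S : ℕ, R ≤ reg.a k * (2 * S + 1) → let N : ℕ := 2 * S + 1; let mq : Fin Nf → ℝ := fun f => reg.mcrit k + reg.a k * m f / reg.Zm k; let wt : GaugeConfig 4 N (Matrix.specialUnitaryGroup (Fin 3) ℂ) → ℝ := fun U => ∏ f, ‖fermionDet (wilsonDirac (fundamentalRep (Fin 3)) U (mq f) 1)‖; let P : (GaugeConfig 4 N (Matrix.specialUnitaryGroup (Fin 3) ℂ) → Prop) → ℝ := fun E => (∫ U, (if E U then (1 : ℝ) else 0) * wt U ∂(wilsonMeasure (d := 4) (L := N) (fundamentalRep (Fin 3)) (reg.β k))) / (∫ U, wt U ∂(wilsonMeasure (d := 4) (L := N) (fundamentalRep (Fin 3)) (reg.β k))); let J : ℕ := Nat.log 2 (⌊ℓ / reg.a k⌋₊ / b₀) + 1; ∃ δ : ℕ → ℝ, ∑ j ∈ Finset.range J, δ j ≤ ε ∧ ∀ j < J, ∀ s : Fin 4 → ℕ, (∀ i, b₀ * 2 ^ j ≤ s i ∧ s i < b₀ * 2 ^ (j + 2) ∧ s i ≤ N ∧ (s i : ℝ) * reg.a k ≤ ℓ) → P (fun U =>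 ∃ f, IsSignDefect U (mq f) j s) ≤ δ j) ∧ (∀ M : ℝ, M₀ < M → ∀ᶠ k : ℕ in Filter.atTop, ∀ S : ℕ, R ≤ reg.a k * (2 * S + 1) → let N : ℕ := 2 * S + 1; let mq : Fin Nf → ℝ := fun f => reg.mcrit k + reg.a k * m f / reg.Zm k; let wt : GaugeConfig 4 N (Matrix.specialUnitaryGroup (Fin 3) ℂ) → ℝ := fun U => ∏ f, ‖fermionDet (wilsonDirac (fundamentalRep (Fin 3)) U (mq f) 1)‖; (1 / 4 : ℝ) ≤ (∫ U, (if (fermionDet (wilsonDirac (fundamentalRep (Fin 3)) U (reg.mcrit k - reg.a k * M / reg.Zm k) 1)).re < 0 then (1 : ℝ) else 0) * wt U ∂(wilsonMeasure (d := 4) (L := N) (fundamentalRep (Fin 3)) (reg.β k))) / (∫ U, wt U ∂(wilsonMeasure (d := 4) (L := N) (fundamentalRep (Fin 3)) (reg.β k))))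

/-- **`SeparatorLawLarge`** — VERBATIM the type of the registered open stub `stub_separatorLawLarge` of
`Cruxes/CoerciveSea/Lines/chirality_collapses_pseudospectrum.lean` (clause (i) on large window boxes along every
physical-branch regularisation carrying the pinned-dilute body; the research content shared by cruxes 13901 and
14759). `SeparatorLawOnBranch` implies it by weakening (`separatorLawLarge_of_onBranch` in the skeleton); with
`PinnedDilutionOnPhysicalBranch` it gives `CoerciveSea` by the landed composition p108820. -/
def SeparatorLawLarge : Prop :=
  ∀ (Nf : ℕ) (reg : QCDRegularisation Nf), (Nf = 2 ∨ Nf = 3) → reg.HasMassScaling → (reg.scheme 0 0 0).HasAsymptoticScaling → Filter.Tendsto reg.mcrit Filter.atTop (nhds 0) → ∀ M₀ : ℝ, 0 ≤ M₀ → ∀ b₀ : ℕ, 2 ≤ b₀ → ∀ ℓ : ℝ, 0 < ℓ → (∀ m : Fin Nf → ℝ, (∀ f, M₀ < m f) → ∃ R : ℝ, 0 < R ∧ (∀ ε : ℝ, 0 < ε → ∀ᶠ k : ℕ in Filter.atTop, ∀ S : ℕ, R ≤ reg.a k * (2 * S + 1) → let N : ℕ := 2 * S + 1; let mq : Fin Nf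 → ℝ := fun f => reg.mcrit k + reg.a k * m f / reg.Zm k; let wt : GaugeConfig 4 N (Matrix.specialUnitaryGroup (Fin 3) ℂ) → ℝ := fun U => ∏ f, ‖fermionDet (wilsonDirac (fundamentalRep (Fin 3)) U (mq f) 1)‖; let P : (GaugeConfig 4 N (Matrix.specialUnitaryGroup (Fin 3) ℂ) → Prop) → ℝ := fun E => (∫ U, (if E U then (1 : ℝ) else 0) * wt U ∂(wilsonMeasure (d := 4) (L := N) (fundamentalRep (Fin 3)) (reg.β k))) / (∫ U, wt U ∂(wilsonMeasure (d := 4) (L := N) (fundamentalRep (Fin 3)) (reg.β k))); let J : ℕ := Nat.log 2 (⌊ℓ / reg.a k⌋₊ / b₀) + 1; ∃ δ : ℕ → ℝ, ∑ j ∈ Finset.range J, δ j ≤ ε ∧ ∀ j < J, ∀ s : Fin 4 → ℕ, (∀ i, b₀ * 2 ^ j ≤ s i ∧ s i < b₀ * 2 ^ (j + 2) ∧ s i ≤ N ∧ (s i : ℝ) * reg.a k ≤ ℓ) → P (fun U => ∃ f, IsSignDefect U (mq f) j s) ≤ δ j) ∧ (∀ M : ℝ, M₀ < M → ∀ᶠ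 k : ℕ in Filter.atTop, ∀ S : ℕ, R ≤ reg.a k * (2 * S + 1) → let N : ℕ := 2 * S + 1; let mq : Fin Nf → ℝ := fun f => reg.mcrit k + reg.a k * m f / reg.Zm k; let wt : GaugeConfig 4 N (Matrix.specialUnitaryGroup (Fin 3) ℂ) → ℝ := fun U => ∏ f, ‖fermionDet (wilsonDirac (fundamentalRep (Fin 3)) U (mq f) 1)‖; (1 / 4 : ℝ) ≤ (∫ U, (if (fermionDet (wilsonDirac (fundamentalRep (Fin 3)) U (reg.mcrit k - reg.a k * M / reg.Zm k) 1)).re < 0 then (1 : ℝ) else 0) * wt U ∂(wilsonMeasure (d := 4) (L := N) (fundamentalRep (Fin 3)) (reg.β k))) / (∫ U, wt U ∂(wilsonMeasure (d := 4) (L := N) (fundamentalRep (Fin 3)) (reg.β k))))) → ∃ M₁ : ℝ, M₀ ≤ M₁ ∧ ∃ ℓ' : ℝ, 0 < ℓ' ∧ ℓ' ≤ ℓ ∧ ∀ m : Fin Nf → ℝ, (∀ f, M₁ < m f) → ∃ R : ℝ, 0 < R ∧ ∃ S₀ : ℕ, ∃ C : ℝ, 0 < C ∧ ∃ α : ℝ,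 0 < α ∧ ∀ᶠ k : ℕ in Filter.atTop, ∀ S : ℕ, R ≤ reg.a k * (2 * S + 1) → let N : ℕ := 2 * S + 1; let mq : Fin Nf → ℝ := fun f => reg.mcrit k + reg.a k * m f / reg.Zm k; let wt : GaugeConfig 4 N (Matrix.specialUnitaryGroup (Fin 3) ℂ) → ℝ := fun U => ∏ f, ‖fermionDet (wilsonDirac (fundamentalRep (Fin 3)) U (mq f) 1)‖; let P : (GaugeConfig 4 N (Matrix.specialUnitaryGroup (Fin 3) ℂ) → Prop) → ℝ := fun E => (∫ U, (if E U then (1 : ℝ) else 0) * wt U ∂(wilsonMeasure (d := 4) (L := N) (fundamentalRep (Fin 3)) (reg.β k))) / (∫ U, wt U ∂(wilsonMeasure (d := 4) (L := N) (fundamentalRep (Fin 3)) (reg.β k))); ∀ s : Fin 4 → ℕ, (∀ i, b₀ ≤ s i ∧ s i ≤ N ∧ (s i : ℝ) * reg.a k ≤ ℓ') → (∀ i, S₀ ≤ s i) → (∀ i j, s i ≤ 2 * s j) → ∀ f : Fin Nf, ∀ t : ℝ, 0 < t → t ≤ 1 → P (fun U => HasSingularSeparator U (mq f) s (t / s 0))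 ≤ C * t ^ α

end Summit.QuantumFields.QCD.Cruxes.CoerciveOfDilute.SeaPaysPoles

end
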